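import Mathlib
import Summits.ValiantsHypothesis.ValiantsHypothesis.Theorems.LacunarySymmetroidMatrixDescartesStubNegRoots
import Summits.ValiantsHypothesis.ValiantsHypothesis.Theorems.KPlusLogSqLawWeakLiftingTowerGraftDissociated
import Summits.ValiantsHypothesis.ValiantsHypothesis.Theorems.KPlusLogSqLawWeakLiftingTowerGraftReduction

/-!
# Tower graft line, head (H2) unconditional: Conjecture B is a statement about DISSOCIATED supports only

With the stubs S2a/S2b (`…TowerGraftDissociated`, p646383) and S3 (`…TowerGraftReduction`) of the line
`Cruxes/WeakLifting/Lines/tower_graft.lean` landed, the line's head (H2) `kPlusLogSqLaw_iff_dissociatedB_of hBlow hTie hR`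
has all three hypotheses discharged.  This file states the resulting UNCONDITIONAL equivalence in the tree, def-free (the
line's `DissociatedB` and `IsDissociated` inlined):

`kPlusLogSqLaw_iff_dissociatedB : KPlusLogSqLaw ↔ ∃ C, ∀ m K d, (d is m-dissociated) → PosRootLawOn m K (2^{C(K+log₂²m)}) d`

— the cell's CONJECTURE B (`KPlusLogSqLaw`, census currency, all supports, all real zeros) holds iff its positive-root form
holds on the m-DISSOCIATED supports alone (distinct class-count vectors of total `m` give distinct exponents; towers / lex
chambers and every generic support are dissociated).  Proof = the line's (H2) argument verbatim (val-idea-24 g0): `→` by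
restriction (`Finset.card_filter_le`); `←`: every support `d` is reached from the dissociated blow-ups `N·d + e`,
`e l = (m+1)^l` (S2b), which stay dissociated (S2a), by the dissociation reduction (S3, `2B+1`), then positive → all real
zeros by the reflection `X ↦ −X` (tree `stub_negRoots`, as in `Census.realRootLawAt_of_posRootLawAt`), constants absorbed (`C ↦ C+3`).
Reading note: the RHS constant absorbs the positive-vs-all-real-roots conversion (`RealRootLawAt` counts all distinct real roots,
`PosRootLawOn` the positive ones; reflection `X ↦ −X` plus the origin) — «the same law up to `C`», on dissociated supports only.
Route-independent imports only (no `Theses` file in the import cone).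

HONEST FRAMING: a structural equivalence about an OPEN conjecture (B ⟺ DissociatedB); neither side is asserted; nothing here
proves `KPlusLogSqLaw`, `WeakLifting` (19561), `MatrixDescartes` (18050) or `VP ≠ VNP`.  Credit: statement and proof architecture
= LINE (B) `tower_graft` (planner val-idea-24 g0, critic val-idea-crit-6 g0); this seat only moved the closed pieces into
`Theorems/`.  Seat: prover val-sym-lift-p2 g17, `--supports stmt-ValiantsHypothesis-19561`.
-/

-- `Summit.ValiantsHypothesis.ValiantsHypothesis.…` repeats a component by the D-0017 layout
-- (single-conjunct summit), which the `dupNamespace` linter flags; the name is mandated.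
set_option linter.dupNamespace false

namespace Summit.ValiantsHypothesis.ValiantsHypothesis.Theorems.KPlusLogSqLaw.TowerGraft

open Polynomial
open Summit.ValiantsHypothesis.ValiantsHypothesis.Theorems.LacunarySymmetroidMatrixDescartes
  (RealRootLawAt KPlusLogSqLaw PosRootLawOn)

/-- **(H2) B ⟺ DISSOCIATED-B, unconditional.**  The cell's Conjecture B (`KPlusLogSqLaw`: every format `(m, K)` obeys the
real-zero row `2^{C(K + log₂² m)}` on every support) holds iff the positive-root row of the same shape holds on every
`m`-DISSOCIATED support (`∀ n n', ∑ n l = m → ∑ n' l = m → ∑ n l · d l = ∑ n' l · d l → n = n'`).  LINE (B) `tower_graft`, head (H2),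
with S2a/S2b/S3 discharged by `blowup_dissociated`, `tower_tieBreaker_dissociated`, `dissociation_reduction`. [this work] -/
theorem kPlusLogSqLaw_iff_dissociatedB :
    KPlusLogSqLaw ↔ ∃ C : ℕ, ∀ (m K : ℕ) (d : Fin K → ℕ),
      (∀ n n' : Fin K → ℕ, ∑ l, n l = m → ∑ l, n' l = m → ∑ l, n l * d l = ∑ l, n' l * d l → n = n') →
        PosRootLawOn m K (2 ^ (C * (K + Nat.log 2 m ^ 2))) d := by
  constructor
  · rintro ⟨C, hC⟩
    refine ⟨C, fun m K d _ S hS => ?_⟩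
    exact (Finset.card_filter_le _ _).trans (hC m K d S hS)
  · rintro ⟨C, hC⟩
    refine ⟨C + 3, fun m K d S hS => ?_⟩
    rcases Nat.eq_zero_or_pos K with hK | hK
    · -- the empty format: the pencil is `0` (or the empty matrix): no counted zeros
      subst hK
      have h0 : (∑ l : Fin 0, (Polynomial.X : Polynomial ℝ) ^ d l • (S l).map Polynomial.C) = 0 := by simp
      rw [h0]
      rcases Nat.eq_zero_or_pos m with hm | hm
      · subst hm
        simp [Matrix.det_isEmpty]
      · haveI : Nonempty (Fin m) := ⟨⟨0, hm⟩⟩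
        simp [Matrix.det_zero]
    set A := C * (K + Nat.log 2 m ^ 2) with hAdef
    -- every support `d` inherits the dissociated bound through the blow-up `N·d + e`, `e l = (m+1)^l`
    have hOn : ∀ d : Fin K → ℕ, PosRootLawOn m K (2 * 2 ^ A + 1) d := by
      intro d
      refine dissociation_reduction m K (2 ^ A) d (fun l : Fin K => (m + 1) ^ (l : ℕ))
        (tower_tieBreaker_dissociated m K) ?_
      intro N hN
      exact hC m K _ (blowup_dissociated m K N d _ (tower_tieBreaker_dissociated m K) hN)
    -- positive zeros of the pencil and of its reflection `X ↦ −X`, plus possibly `0`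
    have h1 := hOn d S hS
    have h2 := hOn d (fun l => ((-1 : ℝ) ^ d l) • S l) (fun l => (hS l).smul _)
    have h3 := Summit.ValiantsHypothesis.ValiantsHypothesis.Theorems.LacunarySymmetroidMatrixDescartes.stub_negRoots K m d S
    refine h3.trans ((Nat.add_le_add (Nat.add_le_add h1 h2) le_rfl).trans ?_)
    -- (2·2^A + 1) + (2·2^A + 1) + 1 ≤ 8·2^A ≤ 2^A · 2^{3(K+L²)} = 2^{(C+3)(K+L²)} with K ≥ 1
    have h5 : (C + 3) * (K + Nat.log 2 m ^ 2) = A + 3 * (K + Nat.log 2 m ^ 2) := by rw [hAdef]; ring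
    have h6 : 3 ≤ 3 * (K + Nat.log 2 m ^ 2) := by omega
    have h7 : 2 ^ 3 ≤ 2 ^ (3 * (K + Nat.log 2 m ^ 2)) := Nat.pow_le_pow_right two_pos h6
    have h8 : 1 ≤ 2 ^ A := Nat.one_le_two_pow
    calc 2 * 2 ^ A + 1 + (2 * 2 ^ A + 1) + 1 ≤ 2 ^ A * 2 ^ 3 := by omega
      _ ≤ 2 ^ A * 2 ^ (3 * (K + Nat.log 2 m ^ 2)) := Nat.mul_le_mul_left (2 ^ A) h7
      _ = 2 ^ ((C + 3) * (K + Nat.log 2 m ^ 2)) := by rw [h5, pow_add]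

end Summit.ValiantsHypothesis.ValiantsHypothesis.Theorems.KPlusLogSqLaw.TowerGraft
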